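import Mathlib
import Summits.Ventures.HodgeRepro.Tier4.Common.AdelicDefs
import Summits.Ventures.HodgeRepro.Tier4.Line1.PlaneDefs
import Summits.Ventures.HodgeRepro.Tier4.Line1.C7Components
import Summits.Ventures.HodgeRepro.Tier4.Line1.RationalRotation
import Summits.Ventures.HodgeRepro.Tier4.Line1.PlacesFinite
import Summits.Ventures.HodgeRepro.Tier4.Line1.IntegralWittIsometry

/-!
# Tier4/Line1/C7IntegralTransitive — LINE L1, rung C7.2: INTEGRAL TRANSITIVITY AT ALMOST ALL FINITE PLACES

Blind re-derivation cell `pub-hodge-repro`, Tier 4 (README §9–§10), seat t4-L1-p1 g2 (STATUS.md S13090).  The rung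
C7.2 `exists_finset_integral_transitive` of t4-L1-p4's typed C7 census (proofs/t4/L1/C7-rungs-sig.lean L139–L144;
binder `h72` of the residual lemma `quotient_compact_of_rungs`, Skeleton v0.28 L674; consumed by the assembly
`exists_compact_stab_mul_of_rungs'`, C7Assembly p672987), statement VERBATIM: outside a finite set `S₀` of finite
places, `U(W)(𝓞_v)` moves the rational vector `v₀` to every integral vector of its `U(W)(k_v)`-orbit — if `h ∈ localU W v`
has `v₀ h ∈ 𝓞_v⁴` then some `κ ∈ localUInt W v` has `v₀ κ = v₀ h`.  (Module name: the path `Tier4/Line1/C7IntegralWitt`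
carries t4-L1-p2's packaging `exists_finset_integral_transitive_of_integralWitt` = C7.2 modulo a displayed integral-Witt
binder, p675071; this module is the UNCONDITIONAL C7.2, the lemma of record for the census line.)

PROOF.  (C7.2b) `S₀` = the places at which some entry of `B`, `Ω`, `v₀` is not integral or one of `d` (`Ω² = −d`),
`det B`, `α = v₀ B v₀ᵀ` (non-zero by `IsDefinite`) and `2` is not a unit: finitely many, by t4-L2-p2's
`exists_finset_isUnit_outside_of_fintype` (PlacesFinite p674610: a finite family of elements of `k` and their inverses
is integral outside a finite set of places) applied to the family of all these elements.  (C7.2c) At `v ∉ S₀` the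
data read in `k_v` satisfy every
hypothesis of the field-generic INTEGRAL WITT theorem `IntWitt.exists_integral_isometry_vecMul_eq`
(Tier4/Line1/IntegralWittIsometry, row picture) with `𝓞 := 𝓞_v = v.adicCompletionIntegers k` — the vector `y = v₀ h` is
integral by hypothesis and has the norm of `v₀` by unitarity of `h` — and the integral isometry it produces is the
`κ`.  No print is consumed: the integral Witt theorem is proved in the tree (residue-field argument, no Jacobowitz).

Nothing here says anything about the status of the Hodge conjecture for CM abelian varieties, which is NOT proved
(HC_CM is NOT proved by anyone in this repository).
-/

set_option autoImplicit false

noncomputable section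

namespace Summit.Ventures.HodgeRepro.Tier4.Line1

open NumberField IsDedekindDomain HeightOneSpectrum Topology Common Matrix

section Places

variable {k : Type} [Field k] [NumberField k]

/-- `k_v` has characteristic `0`. -/
theorem charZero_adicCompletion (v : HeightOneSpectrum (𝓞 k)) : CharZero (v.adicCompletion k) :=
  charZero_of_injective_algebraMap (algebraMap k (v.adicCompletion k)).injective

/-- a rational `a ≠ 0` with `a` and `a⁻¹` integral at `v` is a unit of `𝓞_v`. -/
theorem isUnitIn_algebraMap_of_mem {v : HeightOneSpectrum (𝓞 k)} {a : k} (ha : a ≠ 0)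
    (h : algebraMap k (v.adicCompletion k) a ∈ v.adicCompletionIntegers k ∧
      algebraMap k (v.adicCompletion k) a⁻¹ ∈ v.adicCompletionIntegers k) :
    IntWitt.IsUnitIn (v.adicCompletionIntegers k) (algebraMap k (v.adicCompletion k) a) :=
  ⟨(map_ne_zero _).mpr ha, h.1, by rw [← map_inv₀]; exact h.2⟩

end Places

section C72

variable {k : Type} [Field k] [NumberField k] (W : PlaneData k)

/-- (C7.2, WALL of the C7 census — PROVED) INTEGRAL TRANSITIVITY AT ALMOST ALL FINITE PLACES: outside a finite set
`S₀` of finite places, `U(W)(𝓞_v)` moves `v₀` to every integral vector of its sphere — if `h ∈ U(W)(k_v)` has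
`v₀ h ∈ 𝓞_v⁴` then some `κ ∈ U(W)(𝓞_v)` has `v₀ κ = v₀ h`.  Statement verbatim from proofs/t4/L1/C7-rungs-sig.lean
L139–L144 (t4-L1-p4).  Proof: `S₀` = the non-integral places of the entries of `B`, `Ω`, `v₀` and the non-unit places
of `d`, `det B`, `v₀ B v₀ᵀ`, `2` (ONE finite family, t4-L2-p2's `exists_finset_isUnit_outside_of_fintype`); outside it,
the field-generic integral Witt theorem
`IntWitt.exists_integral_isometry_vecMul_eq` applied in `k_v` with `𝓞 = 𝓞_v`. -/
theorem exists_finset_integral_transitive (hg : IsGenuineRow W) (hW : IsDefinite W)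
    (v₀ : Fin 4 → k) (hv₀ : v₀ ≠ 0) :
    ∃ S₀ : Finset (HeightOneSpectrum (𝓞 k)), ∀ v ∉ S₀, ∀ h ∈ localU W v,
      (∀ i, (finRat v v₀ ᵥ* h) i ∈ v.adicCompletionIntegers k) →
        ∃ κ ∈ localUInt W v, finRat v v₀ ᵥ* κ = finRat v v₀ ᵥ* h := by
  obtain ⟨⟨d, hΩ, hd⟩, hrow, -, -, -, -⟩ := hg
  have hd0 : d ≠ 0 := by
    rintro rfl
    exact hd ⟨0, by simp⟩
  have hdetB : W.B.det ≠ 0 := by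
    have := isUnit_B_of_isDefinite W hW
    rw [Matrix.isUnit_iff_isUnit_det, isUnit_iff_ne_zero] at this
    exact this
  have hα0 : (v₀ ᵥ* W.B) ⬝ᵥ v₀ ≠ 0 := by
    have e : (v₀ ᵥ* W.B) ⬝ᵥ v₀ = v₀ ⬝ᵥ (W.B *ᵥ v₀) := by
      rw [← mulVec_transpose, W.B_symm, dotProduct_comm]
    rw [e]
    exact pair_self_ne_zero_of_isDefinite W hW hv₀
  -- the exceptional set: ONE finite family (the entries of `B`, `Ω`, `v₀` and `d`, `det B`, `v₀ B v₀ᵀ`, `2`)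
  let f : (Fin 4 × Fin 4) ⊕ ((Fin 4 × Fin 4) ⊕ (Fin 4 ⊕ Fin 4)) → k :=
    Sum.elim (fun p => W.B p.1 p.2)
      (Sum.elim (fun p => W.Ω p.1 p.2) (Sum.elim v₀ ![d, W.B.det, (v₀ ᵥ* W.B) ⬝ᵥ v₀, 2]))
  obtain ⟨S₀, hS₀⟩ := exists_finset_isUnit_outside_of_fintype f
  refine ⟨S₀, ?_⟩
  intro v hv h hh hint
  have hf := hS₀ v hv
  have hvB : ∀ i j, algebraMap k (v.adicCompletion k) (W.B i j) ∈ v.adicCompletionIntegers k :=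
    fun i j => (hf (Sum.inl (i, j))).1
  have hvΩ : ∀ i j, algebraMap k (v.adicCompletion k) (W.Ω i j) ∈ v.adicCompletionIntegers k :=
    fun i j => (hf (Sum.inr (Sum.inl (i, j)))).1
  have hvv₀ : ∀ i, algebraMap k (v.adicCompletion k) (v₀ i) ∈ v.adicCompletionIntegers k :=
    fun i => (hf (Sum.inr (Sum.inr (Sum.inl i)))).1
  have hvd := hf (Sum.inr (Sum.inr (Sum.inr 0)))
  have hvdet := hf (Sum.inr (Sum.inr (Sum.inr 1)))
  have hvα := hf (Sum.inr (Sum.inr (Sum.inr 2)))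
  have hv2 := hf (Sum.inr (Sum.inr (Sum.inr 3)))
  simp only [f, Sum.elim_inr, Matrix.cons_val_zero, Matrix.cons_val_one, Matrix.head_cons,
    Matrix.cons_val_two, Matrix.cons_val_three, Matrix.tail_cons] at hvd hvdet hvα hv2
  -- the data read in `k_v`
  set φ : k →+* v.adicCompletion k := algebraMap k (v.adicCompletion k) with hφ
  haveI : CharZero (v.adicCompletion k) := charZero_adicCompletion v
  have hB_symm : (W.B.map φ)ᵀ = W.B.map φ := by
    rw [← Matrix.transpose_map, W.B_symm]
  have hrow_v : W.Ω.map φ * W.B.map φ = -(W.B.map φ * (W.Ω.map φ)ᵀ) := by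
    have this : (W.Ω * W.B).map φ = (-(W.B * W.Ωᵀ)).map φ := by rw [hrow]
    rw [Matrix.map_mul, Matrix.map_neg _ (map_neg φ), Matrix.map_mul, Matrix.transpose_map] at this
    exact this
  have hone : ((d • (1 : Matrix (Fin 4) (Fin 4) k)).map φ) = φ d • (1 : Matrix (Fin 4) (Fin 4) (v.adicCompletion k)) := by
    ext i j
    simp only [Matrix.map_apply, Matrix.smul_apply, Matrix.one_apply, smul_eq_mul, mul_ite, mul_one, mul_zero]
    split_ifs <;> simp
  have hΩ_v : W.Ω.map φ * W.Ω.map φ = -(φ d • (1 : Matrix (Fin 4) (Fin 4) (v.adicCompletion k))) := by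
    have this : (W.Ω * W.Ω).map φ = (-(d • (1 : Matrix (Fin 4) (Fin 4) k))).map φ := by rw [hΩ]
    rw [Matrix.map_mul, Matrix.map_neg _ (map_neg φ), hone] at this
    exact this
  have hB_int : ∀ i j, (W.B.map φ) i j ∈ v.adicCompletionIntegers k := fun i j => hvB i j
  have hΩ_int : ∀ i j, (W.Ω.map φ) i j ∈ v.adicCompletionIntegers k := fun i j => hvΩ i j
  have hdet_v : IntWitt.IsUnitIn (v.adicCompletionIntegers k) (W.B.map φ).det := by
    have : (W.B.map φ).det = φ W.B.det := by
      rw [RingHom.map_det, RingHom.mapMatrix_apply]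
    rw [this]
    exact isUnitIn_algebraMap_of_mem hdetB hvdet
  have hd_v : IntWitt.IsUnitIn (v.adicCompletionIntegers k) (φ d) :=
    isUnitIn_algebraMap_of_mem hd0 hvd
  have h2_v : (2 : v.adicCompletion k)⁻¹ ∈ v.adicCompletionIntegers k := by
    have h2 : (2 : v.adicCompletion k) = φ 2 := (map_ofNat φ 2).symm
    rw [h2]
    exact (isUnitIn_algebraMap_of_mem two_ne_zero hv2).inv_mem
  have hx_int : ∀ i, finRat v v₀ i ∈ v.adicCompletionIntegers k := fun i => hvv₀ i
  have hα_v : IntWitt.IsUnitIn (v.adicCompletionIntegers k) ((finRat v v₀ ᵥ* W.B.map φ) ⬝ᵥ finRat v v₀) := by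
    have : (finRat v v₀ ᵥ* W.B.map φ) ⬝ᵥ finRat v v₀ = φ ((v₀ ᵥ* W.B) ⬝ᵥ v₀) := by
      rw [RingHom.map_dotProduct]
      congr 1
      funext i
      exact (RingHom.map_vecMul φ W.B v₀ i).symm
    rw [this]
    exact isUnitIn_algebraMap_of_mem hα0 hvα
  -- `y = v₀ h` has the norm of `v₀` (unitarity of `h`)
  obtain ⟨hhΩ, hhB⟩ := hh
  have hxy_v : (finRat v v₀ ᵥ* W.B.map φ) ⬝ᵥ finRat v v₀ =
      ((finRat v v₀ ᵥ* h) ᵥ* W.B.map φ) ⬝ᵥ (finRat v v₀ ᵥ* h) := by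
    rw [vecMul_vecMul, ← mulVec_transpose h (finRat v v₀), dotProduct_mulVec, vecMul_vecMul, hhB]
  obtain ⟨γ, hγint, hγΩ, hγB, hγx⟩ := IntWitt.exists_integral_isometry_vecMul_eq hB_symm hrow_v hΩ_v
    hB_int hΩ_int hdet_v hd_v h2_v hx_int hint hα_v hxy_v
  exact ⟨γ, ⟨⟨hγΩ, hγB⟩, hγint⟩, hγx⟩

end C72

end Summit.Ventures.HodgeRepro.Tier4.Line1

end
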